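import Summits.QuantumFields.QCD.Theses.RenormalisedVafaWitten
import Literature.MathematicalPhysics.QuantumFieldTheory.QCDGoldstoneBound
import HarnessLib.Audit

/-!
# Birth skeleton (BC3) for the crux `LineShieldedChiralContinuum` (item stmt-QuantumFields-17662)

Route `RenormalisedVafaWitten` (sub-problem QCD), crux decl
`Summit.QuantumFields.QCD.Theses.RenormalisedVafaWitten.LineShieldedChiralContinuum` (rev 11, rank 2):

  `∀ N_f ∈ {2,3}, ∃ reg : QCDRegularisation N_f, (i) reg.HasMassScaling ∧ (ii) reg.IsChiralAtZero ∧
     (iii) (∀ m > 0, ∃ z shift T, IsQCDAlong (reg.scheme m z shift) T ∧ T.IsNontrivial glue ∧ T.IsNonGaussian glue ∧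
            ∀ f ≠ g, T.IsNontrivial (pseudoRe f g)) ∧
     (iv) (∀ M̄, ∃ c > 0, ∀ m ∈ (0, M̄]^{N_f}, ∀ f ≠ g, ∃ C, ∀ᶠ k, ∀ S ≥ L_k, ∀ n ≤ S,
            ‖⟨P_fg(0) P_gf(n e₀)⟩_{k,2S+1}‖ ≤ C e^{−c (m_f+m_g) a_k n})`.

Registered by the skeleton-registrar seat `planner-skel-stmt-QuantumFields-17662-0` (route re-audit bin REPAIRABLE,
2026-08-17) as `Cruxes/LineShieldedChiralContinuum/Lines/birth.lean`.  It is the route-level BIRTH CERTIFICATE of the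
crux (≥ 2 named stubs, a kernel-checked composition concluding the crux BY NAME, `sorry` only inside `stub_*`),
deliberately LINE-NEUTRAL: it cuts the existential along the route header's OWN two-layer plan for this node —
"LineShieldedChiralContinuum ⇐ PinnedChiralContinuum (∃ reg with (i)–(iii) AND an intrinsic PIN certificate P(reg)
identifying m_crit(k) with the flow's critical mass …) → PinnedLineShield (∀ reg: HasMassScaling → admissibility →
P(reg) → (iv))" — with the pin TYPED OVER THE STATEMENT'S OWN VOCABULARY as the two-sided physical pin
(chiral side: the eventual Goldstone lower bound `reg.HasGoldstoneBound`, the tree's subsequence-stable strengthening of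
`IsChiralAtZero`, verbatim the clause G of `DiagonalSpine.ChiralTuning`; massive side: `FlavouredChannelMassive reg`,
the flavour-changing pseudoscalar channel decays at SOME physical rate μ(m) > 0 at every positive tuple — clause (iv)
with its structured rate c(M̄)(m_f+m_g) forgotten), and with the existence half PinnedChiralContinuum itself cut into
its LATTICE part and its CONTINUUM part along a subsequence (the tree's `QCDRegularisation.restrict`):

* `stub_pinnedChiralLattice : Stmt.stub_pinnedChiralLattice` (open-problem; lattice only) — for N_f ∈ {2,3} there is a
  mass-independent regularisation with leading-log mass scaling, two-loop asymptotic scaling, `m_crit(k) > −1`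
  eventually, the eventual Goldstone lower bound (the gap closes as m → 0⁺, subsequence-stably) AND a massive
  flavour-changing pseudoscalar channel at every positive renormalised tuple.  No continuum clause, no full gap.
* `stub_continuumAlongSubsequence : Stmt.stub_continuumAlongSubsequence` (open-problem; the UV/OS half) — EVERY such
  regularisation has a subsequence of cutoffs along which, for EVERY positive tuple, species renormalisations and OS
  data exist with `IsQCDAlong`, non-trivial non-Gaussian glue and non-decoupled flavour-changing pseudoscalars
  (clause (iii) of the crux for the reindexed regularisation; existence along ONE subsequence, not universality).
* `stub_pinnedLineShield : Stmt.stub_pinnedLineShield` (open-problem; THE ROUTE'S BET, the header's PinnedLineShield)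
  — for every regularisation carrying (i), (ii), (iii) and a massive flavour-changing pseudoscalar channel, the rate is
  UNIFORMLY LINEAR IN THE RENORMALISED MASSES on every window: clause (iv), the renormalised Vafa–Witten inequality
  m_π(m) ≥ c(M̄)(m_f + m_g) for m ∈ (0, M̄]^{N_f}, k- and volume-uniformly.

`LineShieldedChiralContinuum_of : Stmt.stub_pinnedChiralLattice → Stmt.stub_continuumAlongSubsequence →
Stmt.stub_pinnedLineShield → LineShieldedChiralContinuum` is kernel-checked: the lattice stub yields `reg`; the
continuum law yields `φ` and clause (iii) for `reg.restrict φ`; mass scaling and the massive flavoured channel PASS TO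
THE SUBSEQUENCE (`hasMassScaling_restrict`, `flavouredChannelMassive_restrict` — Tendsto/Eventually composed with
`φ → ∞`), the Goldstone bound passes and gives `IsChiralAtZero` THERE (tree `HasGoldstoneBound.isChiralAtZero_restrict`;
this is why the chiral side of the pin is the Goldstone bound and not `IsChiralAtZero`, which is not inherited by
subsequences); the shield law applied to the reindexed regularisation gives (iv).  `lineShieldedChiralContinuum_of_stubs`
instantiates it.  The stub THEOREMS carry their statements fully inlined over tree vocabulary (registry-grade
signatures); `Stmt.stub_<name>` are the same statements phrased with the §0 currency, and `…_of_stubs` is the machine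
check that the two agree.

## Negative knowledge honoured (read 2026-08-17)
* `Cruxes/LineShieldedChiralContinuum/` had NO workfiles before this one (no `Disproof.lean`, no ideas, no dead lines);
  the crux's evidence is the route-repair memo (why existential; threshold-0 rate consistent with GMOR).
* Route header KILL CRITERIA / the re-type probe `shifted_not_chiral`: a threshold-SHIFTED regularisation
  (`m_crit + a_k M₀/Z_m`, M₀ > 0) is not chiral at zero — here the chiral side of the pin (Goldstone bound) excludes
  it, and the sub-critical offsets (M₀ < 0, the header's "hostage" case for any ∀-form of (iv)) are excluded by the
  massive side `FlavouredChannelMassive` (no uniform physical decay at the would-be massless tuple), so the ∀-law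
  `stub_pinnedLineShield` is stated only over honestly pinned regularisations, as the header demands.
* `ledger negatives --problem QuantumFields` (5 entries, 2026-08-17): RobustYangMillsRG stmt-14958 (a wild blocking map
  inhabits an under-constrained admissibility predicate), MirrorModularBoosts stmt-9665 (YangMills), AdaptiveCoarseSystem
  stmt-9494, MultibosonLatticeGap stmt-9599 (shares only the generic prefix `∃ reg, HasMassScaling ∧ HasAsymptoticScaling ∧
  ∀ m > 0, branch ∧ …` with S1; refuted through its unsatisfiable multiboson admissibility clause `Adm` — a monic
  polynomial bounded by `< 2` on an interval of length `≥ 8` — no physics, nothing of it in S1), AdmissibleRootsExist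
  stmt-9603.  No stub is an instance or a rewording of any of them; the lesson applied: the only hypothesis predicates
  of the two ∀-laws are the Statement's own (`HasMassScaling`, `HasAsymptoticScaling`, `IsChiralAtZero`,
  `HasGoldstoneBound`, the physical branch) plus upper bounds on ONE honest torus correlator — nothing bespoke that a
  junk witness could inhabit while the conclusion fails (a junk `0` correlator makes S3's conclusion true as well).
* Typing checklist 4c: no Bochner integral over a free function; no hand-picked threshold or rate (μ, c, C, φ
  existential; M̄ universal as in the crux); the signed `(det D_W)^{N_f}` weight enters only the k,S-uniform
  constants inside S1/S3, conceded in the crux's why-it-might-fail; junk value `0` of `qcdTorusExpect` satisfies the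
  upper bounds of S1/S3 vacuously but is excluded from S1 by the Goldstone LOWER bound.

## BC3 probes (planner folder `bc/LineShieldedChiralContinuum_probes.lean`): for each stub statement `S`,
`S → LineShieldedChiralContinuum` and `S → QCD` by `first | exact? | simpa [S] | (unfold S; simpa) | aesop` FAIL
(statements copied verbatim with no stub or composition in scope; rc and goals in the seat's NOTES.md and in
`Lines/birth.md`).
-/

noncomputable section

namespace Summit.QuantumFields.QCD.Cruxes.LineShieldedChiralContinuum.Birth

open scoped Topology
open Filter
open Literature.MathematicalPhysics.QuantumFieldTheory
open Literature.Probability.LatticeModels (TorusSite)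
open Summit.QuantumFields.QCD.Theses.RenormalisedVafaWitten

/-! ## §0 Currency (the Statement's vocabulary; clauses of the crux, verbatim) -/

/-- **Existence data with dynamical quarks** — clause (iii) of the crux for the regularisation `reg`, verbatim: for
every positive tuple, species renormalisations `z, shift` and OS data `T` with `IsQCDAlong (reg.scheme m z shift) T`,
non-trivial non-Gaussian glue and every flavour-changing pseudoscalar non-trivial.  No gap clause. -/
def ExistenceData {Nf : ℕ} (reg : QCDRegularisation Nf) : Prop :=
  ∀ m : Fin Nf → ℝ, (∀ f, 0 < m f) →
    ∃ (z shift : QCDField Nf → ℕ → ℝ) (T : OSData (QCDField Nf) 4),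
      IsQCDAlong (reg.scheme m z shift) T ∧ T.IsNontrivial QCDField.glue ∧ T.IsNonGaussian QCDField.glue ∧
        ∀ f g : Fin Nf, f ≠ g → T.IsNontrivial (QCDField.pseudoRe f g)

/-- **Massive flavour-changing pseudoscalar channel** (the massive side of the pin): at EVERY positive renormalised
tuple `m` and every `f ≠ g` the torus two-point function `⟨P_fg(0) P_gf(n e₀)⟩_{k,2S+1}` at the bare trajectory of `m`
decays at SOME physical rate `μ = μ(m,f,g) > 0`, eventually in `k`, uniformly on tori `S ≥ L_k` and separations
`n ≤ S` — clause (iv) of the crux with the structured rate `c(M̄)(m_f+m_g)` replaced by an unstructured one (the pion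
of massive QCD is massive; nothing about HOW massive). -/
def FlavouredChannelMassive {Nf : ℕ} (reg : QCDRegularisation Nf) : Prop :=
  ∀ m : Fin Nf → ℝ, (∀ f, 0 < m f) → ∀ f g : Fin Nf, f ≠ g → ∃ μ : ℝ, 0 < μ ∧ ∃ C : ℝ,
    ∀ᶠ k in atTop, ∀ S : ℕ, reg.L k ≤ S → ∀ n : ℕ, n ≤ S →
      ‖qcdTorusExpect (reg.β k) (2 * S + 1) (fun fl => reg.mcrit k + reg.a k * m fl / reg.Zm k)
          (fun _ => pseudoscalarBilinear f g (0 : TorusSite 4 (2 * S + 1)) *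
            pseudoscalarBilinear g f (fun i : Fin 4 => if i = 0 then ((n : ℕ) : ZMod (2 * S + 1)) else 0))‖ ≤
        C * Real.exp (-(μ * (reg.a k * n)))

/-- **The renormalised quark-line shield at threshold zero** — clause (iv) of the crux for `reg`, verbatim: on every
mass window `(0, M̄]^{N_f}` the flavour-changing pseudoscalar channel decays at the RENORMALISED rate
`c(M̄)·(m_f + m_g)·a_k` per Euclidean time step, `k`- and volume-uniformly. -/
def LineShield {Nf : ℕ} (reg : QCDRegularisation Nf) : Prop :=
  ∀ Mbar : ℝ, ∃ c : ℝ, 0 < c ∧ ∀ m : Fin Nf → ℝ, (∀ f, 0 < m f ∧ m f ≤ Mbar) → ∀ f g : Fin Nf, f ≠ g →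
    ∃ C : ℝ, ∀ᶠ k in atTop, ∀ S : ℕ, reg.L k ≤ S → ∀ n : ℕ, n ≤ S →
      ‖qcdTorusExpect (reg.β k) (2 * S + 1) (fun fl => reg.mcrit k + reg.a k * m fl / reg.Zm k)
          (fun _ => pseudoscalarBilinear f g (0 : TorusSite 4 (2 * S + 1)) *
            pseudoscalarBilinear g f (fun i : Fin 4 => if i = 0 then ((n : ℕ) : ZMod (2 * S + 1)) else 0))‖ ≤
        C * Real.exp (-(c * (m f + m g) * (reg.a k * n)))

/-- **Pinned chiral lattice regularisation** (the lattice-level hypothesis list shared by the three stubs): leading-log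
mass scaling, two-loop asymptotic scaling of `β_k` against `a_k`, critical bare mass eventually on the physical branch,
the eventual Goldstone lower bound (chiral side of the pin) and a massive flavour-changing pseudoscalar channel
(massive side of the pin).  Purely lattice: no OS data, no uniform gap on any other channel. -/
def PinnedChiralLattice {Nf : ℕ} (reg : QCDRegularisation Nf) : Prop :=
  reg.HasMassScaling ∧ (reg.scheme 0 0 0).HasAsymptoticScaling ∧ (∀ᶠ k in atTop, (-1 : ℝ) < reg.mcrit k) ∧
    reg.HasGoldstoneBound ∧ FlavouredChannelMassive reg

/-! ## §1 The three stub statements (`Stmt.stub_<name>` is the statement of the stub `stub_<name>`) -/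

/-- **(S1) Pinned chiral lattice regularisation exists** (lattice half of the header's PinnedChiralContinuum;
open-problem).  For `N_f ∈ {2,3}` there is a mass-independent Wilson regularisation with leading-log mass scaling,
two-loop asymptotic scaling, `m_crit(k) > −1` eventually, the eventual Goldstone lower bound (for every `ε > 0` some
positive tuple and one channel with an eventual lower bound `c e^{−μ a_k n_k}`, `μ < ε`, along physical times
`a_k n_k → ∞`: the lattice gap closes as `m → 0⁺`) and a flavour-changing pseudoscalar channel that is massive in
physical units at every positive tuple.  Why plausibly true: with `m_crit(k)` tuned onto the Wilson chiral line the
pion is light as `m → 0⁺` (Gell-Mann–Oakes–Renner / anomaly) and massive at every `m > 0`.  Why it might fail: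
volume-uniform decay of the pion channel with LIGHT dynamical Wilson quarks along `β_k → ∞` is proved for no
expansion (`a_k μ ~ e^{−1/(2b₀g₀²)}`), the weight `(det D_W)^{N_f}` is signed near `m_crit` for `N_f = 3`, and an
Aoki finger of physical width at the chiral line would break the Goldstone side.  Size: open-problem. -/
def Stmt.stub_pinnedChiralLattice : Prop :=
  ∀ Nf : ℕ, (Nf = 2 ∨ Nf = 3) → ∃ reg : QCDRegularisation Nf, PinnedChiralLattice reg

/-- **(S2) Continuum with dynamical quarks along a subsequence** (continuum half of PinnedChiralContinuum;
open-problem).  For `N_f ∈ {2,3}` and EVERY pinned chiral lattice regularisation there is a strictly increasing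
`φ : ℕ → ℕ` such that the reindexed regularisation `reg.restrict φ` carries clause (iii): at every positive tuple,
`z, shift, T` with `IsQCDAlong`, non-trivial non-Gaussian glue, every flavour-changing pseudoscalar non-trivial.
Why plausibly true: `k`-uniform `E0′` bounds give compactness of the lattice Schwinger functions, mass-equicontinuity
lets ONE diagonal subsequence serve all tuples, `E1` is restored along asymptotically scaling sequences, and the pin
(Goldstone side ⇒ offset `M₀ ≤ 0`, massive side ⇒ `M₀ ≥ 0`) makes the quarks honest-light, hence non-decoupled at every
`m`.  Why it might fail: UV stability with light dynamical Wilson quarks (off-diagonal `E0′`, rotation restoration,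
mass-equicontinuity down to `m → 0⁺`) is proved for no 4d gauge theory; non-decoupling must be read off lattice data
alone.  Size: open-problem. -/
def Stmt.stub_continuumAlongSubsequence : Prop :=
  ∀ Nf : ℕ, (Nf = 2 ∨ Nf = 3) → ∀ reg : QCDRegularisation Nf, PinnedChiralLattice reg →
    ∃ (φ : ℕ → ℕ) (hφ : StrictMono φ), ExistenceData (reg.restrict φ hφ.tendsto_atTop)

/-- **(S3) The pinned line shield** (the header's PinnedLineShield, THE ROUTE'S BET; open-problem).  For
`N_f ∈ {2,3}` and every regularisation with leading-log mass scaling, chiral at zero, carrying existence data with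
dynamical quarks and a massive flavour-changing pseudoscalar channel, the rate is UNIFORMLY LINEAR in the renormalised
masses on every window: clause (iv).  Content: the renormalised paramagnetic (Vafa–Witten-type) LOWER bound on the
flavoured gap, `μ⋆(m,f,g) ≥ c(M̄)(m_f+m_g)` on `(0, M̄]^{N_f}` — local uniformity of the best rate on compacts plus at
most linear vanishing at the chiral corner (GMOR gives `√(B(m_f+m_g)) ≫ c(m_f+m_g)`).  Why it might fail: the
`k,S`-uniform constant fights `⟨sign⟩⁻¹` for `N_f = 3` / split `N_f = 2`; accretivity of the blocked Wilson kernel at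
the RUNNING mass is not RG-covariant; a superlinearly soft pion (`m_π = o(m)`) in some exotic chiral scenario would
refute it.  Size: open-problem. -/
def Stmt.stub_pinnedLineShield : Prop :=
  ∀ Nf : ℕ, (Nf = 2 ∨ Nf = 3) → ∀ reg : QCDRegularisation Nf, reg.HasMassScaling → reg.IsChiralAtZero →
    ExistenceData reg → FlavouredChannelMassive reg → LineShield reg

/-! ## §2 The registered stubs (the ONLY `sorry`s of this file; signatures fully inlined over tree vocabulary) -/

/-- (S1) pinned chiral lattice regularisation — open-problem (lattice IR with light quarks). -/
theorem stub_pinnedChiralLattice :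
    ∀ Nf : ℕ, (Nf = 2 ∨ Nf = 3) → ∃ reg : QCDRegularisation Nf,
      reg.HasMassScaling ∧ (reg.scheme 0 0 0).HasAsymptoticScaling ∧ (∀ᶠ k in atTop, (-1 : ℝ) < reg.mcrit k) ∧
        reg.HasGoldstoneBound ∧
          (∀ m : Fin Nf → ℝ, (∀ f, 0 < m f) → ∀ f g : Fin Nf, f ≠ g → ∃ μ : ℝ, 0 < μ ∧ ∃ C : ℝ,
            ∀ᶠ k in atTop, ∀ S : ℕ, reg.L k ≤ S → ∀ n : ℕ, n ≤ S →
              ‖qcdTorusExpect (reg.β k) (2 * S + 1) (fun fl => reg.mcrit k + reg.a k * m fl / reg.Zm k)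
                  (fun _ => pseudoscalarBilinear f g (0 : TorusSite 4 (2 * S + 1)) *
                    pseudoscalarBilinear g f
                      (fun i : Fin 4 => if i = 0 then ((n : ℕ) : ZMod (2 * S + 1)) else 0))‖ ≤
                C * Real.exp (-(μ * (reg.a k * n)))) := by
  sorry

/-- (S2) continuum with dynamical quarks along a subsequence — open-problem (UV/OS half). -/
theorem stub_continuumAlongSubsequence :
    ∀ Nf : ℕ, (Nf = 2 ∨ Nf = 3) → ∀ reg : QCDRegularisation Nf,
      (reg.HasMassScaling ∧ (reg.scheme 0 0 0).HasAsymptoticScaling ∧ (∀ᶠ k in atTop, (-1 : ℝ) < reg.mcrit k) ∧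
        reg.HasGoldstoneBound ∧
          (∀ m : Fin Nf → ℝ, (∀ f, 0 < m f) → ∀ f g : Fin Nf, f ≠ g → ∃ μ : ℝ, 0 < μ ∧ ∃ C : ℝ,
            ∀ᶠ k in atTop, ∀ S : ℕ, reg.L k ≤ S → ∀ n : ℕ, n ≤ S →
              ‖qcdTorusExpect (reg.β k) (2 * S + 1) (fun fl => reg.mcrit k + reg.a k * m fl / reg.Zm k)
                  (fun _ => pseudoscalarBilinear f g (0 : TorusSite 4 (2 * S + 1)) *
                    pseudoscalarBilinear g f
                      (fun i : Fin 4 => if i = 0 then ((n : ℕ) : ZMod (2 * S + 1)) else 0))‖ ≤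
                C * Real.exp (-(μ * (reg.a k * n))))) →
      ∃ (φ : ℕ → ℕ) (hφ : StrictMono φ), ∀ m : Fin Nf → ℝ, (∀ f, 0 < m f) →
        ∃ (z shift : QCDField Nf → ℕ → ℝ) (T : OSData (QCDField Nf) 4),
          IsQCDAlong ((reg.restrict φ hφ.tendsto_atTop).scheme m z shift) T ∧ T.IsNontrivial QCDField.glue ∧
            T.IsNonGaussian QCDField.glue ∧ ∀ f g : Fin Nf, f ≠ g → T.IsNontrivial (QCDField.pseudoRe f g) := by
  sorry

/-- (S3) the pinned line shield — open-problem (the route's bet: the renormalised Vafa–Witten inequality). -/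
theorem stub_pinnedLineShield :
    ∀ Nf : ℕ, (Nf = 2 ∨ Nf = 3) → ∀ reg : QCDRegularisation Nf, reg.HasMassScaling → reg.IsChiralAtZero →
      (∀ m : Fin Nf → ℝ, (∀ f, 0 < m f) →
        ∃ (z shift : QCDField Nf → ℕ → ℝ) (T : OSData (QCDField Nf) 4),
          IsQCDAlong (reg.scheme m z shift) T ∧ T.IsNontrivial QCDField.glue ∧ T.IsNonGaussian QCDField.glue ∧
            ∀ f g : Fin Nf, f ≠ g → T.IsNontrivial (QCDField.pseudoRe f g)) →
      (∀ m : Fin Nf → ℝ, (∀ f, 0 < m f) → ∀ f g : Fin Nf, f ≠ g → ∃ μ : ℝ, 0 < μ ∧ ∃ C : ℝ,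
        ∀ᶠ k in atTop, ∀ S : ℕ, reg.L k ≤ S → ∀ n : ℕ, n ≤ S →
          ‖qcdTorusExpect (reg.β k) (2 * S + 1) (fun fl => reg.mcrit k + reg.a k * m fl / reg.Zm k)
              (fun _ => pseudoscalarBilinear f g (0 : TorusSite 4 (2 * S + 1)) *
                pseudoscalarBilinear g f (fun i : Fin 4 => if i = 0 then ((n : ℕ) : ZMod (2 * S + 1)) else 0))‖ ≤
            C * Real.exp (-(μ * (reg.a k * n)))) →
      ∀ Mbar : ℝ, ∃ c : ℝ, 0 < c ∧ ∀ m : Fin Nf → ℝ, (∀ f, 0 < m f ∧ m f ≤ Mbar) → ∀ f g : Fin Nf, f ≠ g →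
        ∃ C : ℝ, ∀ᶠ k in atTop, ∀ S : ℕ, reg.L k ≤ S → ∀ n : ℕ, n ≤ S →
          ‖qcdTorusExpect (reg.β k) (2 * S + 1) (fun fl => reg.mcrit k + reg.a k * m fl / reg.Zm k)
              (fun _ => pseudoscalarBilinear f g (0 : TorusSite 4 (2 * S + 1)) *
                pseudoscalarBilinear g f (fun i : Fin 4 => if i = 0 then ((n : ℕ) : ZMod (2 * S + 1)) else 0))‖ ≤
            C * Real.exp (-(c * (m f + m g) * (reg.a k * n))) := by
  sorry

/-! ## §3 Composition (kernel-checked; no `sorry` below this line) -/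

section Restrict

variable {Nf : ℕ} {reg : QCDRegularisation Nf} {φ : ℕ → ℕ} {hφ : Tendsto φ atTop atTop}

/-- Leading-log mass scaling passes to every reindexing `φ → ∞` (`Z_m ∘ φ`, `a ∘ φ`). [folklore] -/
theorem hasMassScaling_restrict (h : reg.HasMassScaling) : (reg.restrict φ hφ).HasMassScaling := by
  obtain ⟨c, hc, ht⟩ := h
  exact ⟨c, hc, ht.comp hφ⟩

/-- A massive flavour-changing pseudoscalar channel passes to every reindexing `φ → ∞` (same rates and constants;
`∀ᶠ` along `atTop` composed with `φ`). [folklore] -/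
theorem flavouredChannelMassive_restrict (h : FlavouredChannelMassive reg) :
    FlavouredChannelMassive (reg.restrict φ hφ) := by
  intro m hm f g hfg
  obtain ⟨μ, hμ, C, hev⟩ := h m hm f g hfg
  refine ⟨μ, hμ, C, (hφ.eventually hev).mono fun k hk => ?_⟩
  intro S hS n hn
  exact hk S hS n hn

end Restrict

/-- **The crux from the three stubs** (concludes `LineShieldedChiralContinuum` BY NAME).  The lattice stub gives `reg`
with the pinned-chiral-lattice clauses; the continuum law gives a subsequence `φ` and clause (iii) for
`reg.restrict φ`; mass scaling and the massive flavoured channel pass to the subsequence, the Goldstone bound passes and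
yields `IsChiralAtZero` there; the shield law applied to the reindexed regularisation gives clause (iv). -/
theorem LineShieldedChiralContinuum_of :
    Stmt.stub_pinnedChiralLattice → Stmt.stub_continuumAlongSubsequence → Stmt.stub_pinnedLineShield →
      LineShieldedChiralContinuum := by
  intro hL hK hS Nf hNf
  obtain ⟨reg, hpin⟩ := hL Nf hNf
  obtain ⟨φ, hφ, hdata⟩ := hK Nf hNf reg hpin
  obtain ⟨hms, -, -, hG, hM⟩ := hpin
  have hms' : (reg.restrict φ hφ.tendsto_atTop).HasMassScaling := hasMassScaling_restrict hms
  have hchi' : (reg.restrict φ hφ.tendsto_atTop).IsChiralAtZero := hG.isChiralAtZero_restrict φ hφ.tendsto_atTop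
  have hM' : FlavouredChannelMassive (reg.restrict φ hφ.tendsto_atTop) := flavouredChannelMassive_restrict hM
  exact ⟨reg.restrict φ hφ.tendsto_atTop, hms', hchi', hdata, hS Nf hNf _ hms' hchi' hdata hM'⟩

/-- The crux along this skeleton, from the registered stubs (sorries only inside `stub_*`; this is also the machine
check that the inlined stub signatures of §2 agree with the `Stmt.stub_*` statements of §1). -/
theorem lineShieldedChiralContinuum_of_stubs : LineShieldedChiralContinuum :=
  LineShieldedChiralContinuum_of stub_pinnedChiralLattice stub_continuumAlongSubsequence stub_pinnedLineShield

end Summit.QuantumFields.QCD.Cruxes.LineShieldedChiralContinuum.Birth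

end
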